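import Literature.Geometry.Lorentzian.BilinPullbackEstimates
import HarnessLib

/-!
# `Cᵏ` estimates for the coordinate pullback along a map that is `C^{k+1}`-close to the identity

Topic `Geometry/Lorentzian` (namespace `Literature.Geometry.Lorentzian`). A complement to
`BilinPullbackEstimates.lean` (the transformation law `bilinPullback θ B : y ↦ B(θ y)(Dθ_y ·, Dθ_y ·)`
of a covariant `2`-tensor, O'Neill 1983, Ch. 3, Def. 3.9, and its linear `Cᵏ` estimate
`norm_iteratedFDeriv_bilinPullback_le`). Here the coordinate change `θ : E → E` is
**`C^{k+1}`-close to the identity at the point `x`**: `‖Dθ(x) − id‖ ≤ η`, `‖Dᵐθ(x)‖ ≤ η` for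
`2 ≤ m ≤ k + 1`, with `0 ≤ η ≤ 1`. Then, for a field `F` of bilinear forms (a metric deviation in a
chart) and a CONSTANT reference form `B₀` (the flat metric `η` in the application):

* `norm_iteratedFDeriv_bilinPullback_le_of_near_id` — `‖Dᵐ(bilinPullback θ F)(x)‖ ≤ 4ᵏ k! 2^{k+2} N`
  if `‖Dʲ F(θ x)‖ ≤ N` for `j ≤ k` (the linear estimate with Jacobian bound `2`);
* `norm_precomp_comp_comp_sub_le` — order zero for the constant form:
  `‖B₀(L ·, L ·) − B₀‖ ≤ ‖B₀‖ (2η + η²)` for `‖L − id‖ ≤ η`;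
* `norm_iteratedFDeriv_precomp_comp_comp_le` — orders `1 ≤ m ≤ k`:
  `‖Dᵐ(y ↦ B₀(Dθ_y ·, Dθ_y ·))(x)‖ ≤ 2^{m+1} ‖B₀‖ η` (Leibniz: every term contains a derivative of
  the Jacobian of order `≥ 1`, which is `≤ η`);
* `norm_iteratedFDeriv_bilinPullback_add_const_sub_le` — the assembled estimate
  `‖Dᵐ(y ↦ bilinPullback θ (F + B₀)(y) − B₀)(x)‖ ≤ 4ᵏ k! 2^{k+2} N + 2^{k+2} ‖B₀‖ η`, `m ≤ k`:
  pulling a metric `B₀ + F` back along a near-identity coordinate change moves it away from `B₀`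
  by (a constant times) the size of `F` plus (a constant times) `η` — the elementary estimate behind
  "`Cᵏ_loc`-closeness to a fixed background is stable under `C^{k+1}`-small changes of chart"
  (Petersen 2006, Ch. 10, §3.2).

All `[folklore]`; Mathlib's Leibniz (`norm_iteratedFDerivWithin_le_of_bilinear_of_le_one` via the
tree's `norm_iteratedFDeriv_clm_comp_le`) and `ContinuousLinearMap.iteratedFDeriv_comp_left`.
No definitions.

## References
* [ONeill1983] B. O'Neill, *Semi-Riemannian Geometry*, Academic Press 1983, Ch. 3, Def. 3.9.
* [Petersen2006] P. Petersen, *Riemannian Geometry*, 2nd ed., GTM 171, Springer 2006, Ch. 10, §3.2.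
-/

noncomputable section

open Set Filter Topology Function
open scoped ContDiff Nat

namespace Literature.Geometry.Lorentzian

variable {E F : Type*} [NormedAddCommGroup E] [NormedSpace ℝ E] [NormedAddCommGroup F]
  [NormedSpace ℝ F]

/-! ### Linearity of the pullback in the field -/

/-- The coordinate pullback is additive in the field. [folklore] -/
theorem bilinPullback_add (θ : E → F) (B₁ B₂ : F → F →L[ℝ] F →L[ℝ] ℝ) :
    bilinPullback θ (B₁ + B₂) = bilinPullback θ B₁ + bilinPullback θ B₂ := by
  funext y
  ext v w
  simp [bilinPullback_apply]

/-- Pointwise additivity of the coordinate pullback, for fields written as `fun z ↦ B₁ z + B₂ z`.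
[folklore] -/
theorem bilinPullback_add_apply (θ : E → F) (B₁ B₂ : F → F →L[ℝ] F →L[ℝ] ℝ) (y : E) :
    bilinPullback θ (fun z ↦ B₁ z + B₂ z) y = bilinPullback θ B₁ y + bilinPullback θ B₂ y := by
  ext v w
  simp [bilinPullback_apply]

/-- The coordinate pullback of a CONSTANT field `B₀` is `y ↦ B₀(Dθ_y ·, Dθ_y ·)`, i.e.
`(precomp Dθ_y) ∘ B₀ ∘ Dθ_y`. [folklore] -/
theorem bilinPullback_const_apply (θ : E → F) (B₀ : F →L[ℝ] F →L[ℝ] ℝ) (y : E) :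
    bilinPullback θ (fun _ ↦ B₀) y =
      (ContinuousLinearMap.precomp ℝ (fderiv ℝ θ y)).comp (B₀.comp (fderiv ℝ θ y)) := rfl

/-! ### Jets of the Jacobian of a map close to the identity -/

/-- If `‖Dθ(x) − id‖ ≤ η ≤ 1` then `‖Dθ(x)‖ ≤ 2`. [folklore] -/
theorem norm_fderiv_le_two_of_norm_sub_id_le {θ : E → E} {x : E} {η : ℝ} (hη1 : η ≤ 1)
    (h1 : ‖fderiv ℝ θ x - ContinuousLinearMap.id ℝ E‖ ≤ η) : ‖fderiv ℝ θ x‖ ≤ 2 := by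
  have h := norm_le_insert' (fderiv ℝ θ x) (ContinuousLinearMap.id ℝ E)
  linarith [ContinuousLinearMap.norm_id_le (𝕜 := ℝ) (E := E)]

/-- The jets `‖Dⁱθ(x)‖`, `1 ≤ i ≤ k + 1`, of a map `C^{k+1}`-close to the identity at `x` are
bounded by `2`. [folklore] -/
theorem norm_iteratedFDeriv_le_two_of_near_id {θ : E → E} {x : E} {k : ℕ} {η : ℝ}
    (hη1 : η ≤ 1) (h1 : ‖fderiv ℝ θ x - ContinuousLinearMap.id ℝ E‖ ≤ η)
    (h2 : ∀ m, 2 ≤ m → m ≤ k + 1 → ‖iteratedFDeriv ℝ m θ x‖ ≤ η) :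
    ∀ i, 1 ≤ i → i ≤ k + 1 → ‖iteratedFDeriv ℝ i θ x‖ ≤ 2 := by
  intro i h1i hik
  rcases eq_or_lt_of_le h1i with rfl | hlt
  · rw [← norm_iteratedFDeriv_fderiv, norm_iteratedFDeriv_zero]
    exact norm_fderiv_le_two_of_norm_sub_id_le hη1 h1
  · exact (h2 i hlt hik).trans (hη1.trans one_le_two)

/-! ### The pullback of a general field along a near-identity map -/

/-- **The linear `Cᵏ` estimate along a near-identity map.** If `θ` is `C^{k+1}` on an open `s ∋ x`,
`C^{k+1}`-close to the identity at `x` (`‖Dθ(x) − id‖ ≤ η`, `‖Dᵐθ(x)‖ ≤ η` for `2 ≤ m ≤ k + 1`,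
`η ≤ 1`), `F` is `Cᵏ` on an open `t ⊇ θ(s)` with `‖DʲF(θ x)‖ ≤ N` for `j ≤ k`, then
`‖Dᵐ(bilinPullback θ F)(x)‖ ≤ 4ᵏ k! 2^{k+2} N` for `m ≤ k`
(`norm_iteratedFDeriv_bilinPullback_le` with Jacobian bound `2`). [folklore] -/
theorem norm_iteratedFDeriv_bilinPullback_le_of_near_id {θ : E → E}
    {F : E → E →L[ℝ] E →L[ℝ] ℝ} {s t : Set E} (hs : IsOpen s) (ht : IsOpen t) {k : ℕ}
    (hθ : ContDiffOn ℝ (k + 1) θ s) (hF : ContDiffOn ℝ k F t) (hst : MapsTo θ s t)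
    {x : E} (hx : x ∈ s) {η N : ℝ} (hη1 : η ≤ 1) (hN : 0 ≤ N)
    (h1 : ‖fderiv ℝ θ x - ContinuousLinearMap.id ℝ E‖ ≤ η)
    (h2 : ∀ m, 2 ≤ m → m ≤ k + 1 → ‖iteratedFDeriv ℝ m θ x‖ ≤ η)
    (hFb : ∀ j, j ≤ k → ‖iteratedFDeriv ℝ j F (θ x)‖ ≤ N) {m : ℕ} (hm : m ≤ k) :
    ‖iteratedFDeriv ℝ m (bilinPullback θ F) x‖ ≤ 4 ^ k * k ! * 2 ^ (k + 2) * N :=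
  norm_iteratedFDeriv_bilinPullback_le hs ht hθ hF hst hx (by norm_num) hN
    (norm_iteratedFDeriv_le_two_of_near_id hη1 h1 h2) hFb hm

/-! ### The pullback of a constant field along a near-identity map -/

/-- **Order zero**: `‖B₀(L ·, L ·) − B₀‖ ≤ ‖B₀‖ (2η + η²)` whenever `‖L − id‖ ≤ η`
(expand `B₀(v + Wv, w + Ww) − B₀(v, w)` with `W = L − id`). [folklore] -/
theorem norm_precomp_comp_comp_sub_le (B₀ : E →L[ℝ] E →L[ℝ] ℝ) {L : E →L[ℝ] E} {η : ℝ}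
    (hη0 : 0 ≤ η) (hL : ‖L - ContinuousLinearMap.id ℝ E‖ ≤ η) :
    ‖(ContinuousLinearMap.precomp ℝ L).comp (B₀.comp L) - B₀‖ ≤ ‖B₀‖ * (2 * η + η ^ 2) := by
  set W : E →L[ℝ] E := L - ContinuousLinearMap.id ℝ E with hW
  have hLv : ∀ v, L v = v + W v := fun v ↦ by simp [hW]
  have hWv : ∀ v, ‖W v‖ ≤ η * ‖v‖ := fun v ↦
    (W.le_opNorm v).trans (mul_le_mul_of_nonneg_right hL (norm_nonneg v))
  refine ContinuousLinearMap.opNorm_le_bound₂ _ (by positivity) fun v w ↦ ?_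
  have e : ((ContinuousLinearMap.precomp ℝ L).comp (B₀.comp L) - B₀) v w =
      B₀ v (W w) + B₀ (W v) (w + W w) := by
    simp only [sub_apply, ContinuousLinearMap.coe_comp, comp_apply,
      ContinuousLinearMap.precomp_apply, hLv, map_add, add_apply]
    ring
  rw [e]
  have h1 : ‖B₀ v (W w)‖ ≤ ‖B₀‖ * ‖v‖ * (η * ‖w‖) :=
    (B₀.le_opNorm₂ v (W w)).trans (mul_le_mul_of_nonneg_left (hWv w) (by positivity))
  have h2 : ‖B₀ (W v) (w + W w)‖ ≤ ‖B₀‖ * (η * ‖v‖) * (‖w‖ + η * ‖w‖) :=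
    (B₀.le_opNorm₂ (W v) (w + W w)).trans (mul_le_mul
      (mul_le_mul_of_nonneg_left (hWv v) (norm_nonneg B₀))
      ((norm_add_le _ _).trans (add_le_add le_rfl (hWv w))) (norm_nonneg _) (by positivity))
  calc ‖B₀ v (W w) + B₀ (W v) (w + W w)‖ ≤ ‖B₀ v (W w)‖ + ‖B₀ (W v) (w + W w)‖ :=
        norm_add_le _ _
    _ ≤ ‖B₀‖ * ‖v‖ * (η * ‖w‖) + ‖B₀‖ * (η * ‖v‖) * (‖w‖ + η * ‖w‖) := add_le_add h1 h2
    _ = ‖B₀‖ * (2 * η + η ^ 2) * ‖v‖ * ‖w‖ := by ring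

/-- **Orders `1 ≤ m ≤ k`**: if `θ` is `C^{k+1}` on an open `s ∋ x` and `C^{k+1}`-close to the
identity at `x` (`η ≤ 1`), then `‖Dᵐ(y ↦ B₀(Dθ_y ·, Dθ_y ·))(x)‖ ≤ 2^{m+1} ‖B₀‖ η`: in the
Leibniz expansion of the two compositions every term carries a derivative of the Jacobian of order
`≥ 1`, bounded by `η`, against factors bounded by `2`. [folklore] -/
theorem norm_iteratedFDeriv_precomp_comp_comp_le {θ : E → E} (B₀ : E →L[ℝ] E →L[ℝ] ℝ)
    {s : Set E} (hs : IsOpen s) {k : ℕ} (hθ : ContDiffOn ℝ (k + 1) θ s) {x : E} (hx : x ∈ s)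
    {η : ℝ} (hη0 : 0 ≤ η) (hη1 : η ≤ 1)
    (h1 : ‖fderiv ℝ θ x - ContinuousLinearMap.id ℝ E‖ ≤ η)
    (h2 : ∀ m, 2 ≤ m → m ≤ k + 1 → ‖iteratedFDeriv ℝ m θ x‖ ≤ η) {m : ℕ} (hm1 : 1 ≤ m)
    (hm : m ≤ k) :
    ‖iteratedFDeriv ℝ m (fun y ↦ (ContinuousLinearMap.precomp ℝ (fderiv ℝ θ y)).comp
        (B₀.comp (fderiv ℝ θ y))) x‖ ≤ 2 ^ (m + 1) * ‖B₀‖ * η := by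
  -- the Jacobian and its jets at `x`
  set L : E → E →L[ℝ] E := fderiv ℝ θ with hLdef
  have hθk1 : ContDiffOn ℝ ((k : ℕ∞) + 1) θ s := hθ.of_le (by exact_mod_cast le_rfl)
  have hL : ContDiffOn ℝ k L s := hθk1.fderiv_of_isOpen hs le_rfl
  have hLx : ContDiffAt ℝ k L x := hL.contDiffAt (hs.mem_nhds hx)
  have hL2 : ∀ j, j ≤ k → ‖iteratedFDeriv ℝ j L x‖ ≤ 2 := fun j hj ↦ by
    rw [hLdef, norm_iteratedFDeriv_fderiv]
    exact norm_iteratedFDeriv_le_two_of_near_id hη1 h1 h2 (j + 1) (by omega) (by omega)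
  have hLη : ∀ j, 1 ≤ j → j ≤ k → ‖iteratedFDeriv ℝ j L x‖ ≤ η := fun j h1j hj ↦ by
    rw [hLdef, norm_iteratedFDeriv_fderiv]
    exact h2 (j + 1) (by omega) (by omega)
  have hpair : ∀ i j, 1 ≤ i + j → i + j ≤ k →
      ‖iteratedFDeriv ℝ i L x‖ * ‖iteratedFDeriv ℝ j L x‖ ≤ 2 * η := by
    intro i j h1ij hij
    rcases Nat.eq_zero_or_pos i with rfl | hi
    · exact mul_le_mul (hL2 0 (by omega)) (hLη j (by omega) (by omega)) (norm_nonneg _)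
        zero_le_two
    · calc ‖iteratedFDeriv ℝ i L x‖ * ‖iteratedFDeriv ℝ j L x‖ ≤ η * 2 :=
            mul_le_mul (hLη i hi (by omega)) (hL2 j (by omega)) (norm_nonneg _) hη0
        _ = 2 * η := mul_comm η 2
  -- the two factors `P y = precomp (L y)` and `Q y = B₀ ∘ L y`, linear images of `L`
  set P : E → (E →L[ℝ] ℝ) →L[ℝ] E →L[ℝ] ℝ := fun y ↦ ContinuousLinearMap.precomp ℝ (L y)
    with hPdef
  set Q : E → E →L[ℝ] E →L[ℝ] ℝ := fun y ↦ B₀.comp (L y) with hQdef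
  have hPeq : P = (ContinuousLinearMap.compL ℝ E E ℝ).flip ∘ L := by
    funext y
    exact precomp_eq_flip_compL _
  have hQeq : Q = (ContinuousLinearMap.compL ℝ E E (E →L[ℝ] ℝ) B₀) ∘ L := rfl
  have hP : ContDiffOn ℝ k P s := by
    rw [hPeq]
    exact (ContinuousLinearMap.contDiff _).comp_contDiffOn hL
  have hQ : ContDiffOn ℝ k Q s := by
    rw [hQeq]
    exact (ContinuousLinearMap.contDiff _).comp_contDiffOn hL
  have hPb : ∀ i, i ≤ k → ‖iteratedFDeriv ℝ i P x‖ ≤ ‖iteratedFDeriv ℝ i L x‖ := by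
    intro i hi
    rw [hPeq, ContinuousLinearMap.iteratedFDeriv_comp_left _ hLx (by exact_mod_cast hi)]
    refine (ContinuousLinearMap.norm_compContinuousMultilinearMap_le _ _).trans ?_
    have hA : ‖(ContinuousLinearMap.compL ℝ E E ℝ).flip‖ ≤ 1 := by
      rw [ContinuousLinearMap.opNorm_flip]
      exact ContinuousLinearMap.norm_compL_le _ _ _ _
    calc _ ≤ 1 * ‖iteratedFDeriv ℝ i L x‖ :=
          mul_le_mul_of_nonneg_right hA (norm_nonneg _)
      _ = _ := one_mul _
  have hQb : ∀ i, i ≤ k → ‖iteratedFDeriv ℝ i Q x‖ ≤ ‖B₀‖ * ‖iteratedFDeriv ℝ i L x‖ := by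
    intro i hi
    rw [hQeq, ContinuousLinearMap.iteratedFDeriv_comp_left _ hLx (by exact_mod_cast hi)]
    refine (ContinuousLinearMap.norm_compContinuousMultilinearMap_le _ _).trans ?_
    have hA : ‖ContinuousLinearMap.compL ℝ E E (E →L[ℝ] ℝ) B₀‖ ≤ ‖B₀‖ :=
      ContinuousLinearMap.opNorm_le_bound _ (norm_nonneg B₀) fun g ↦ B₀.opNorm_comp_le g
    exact mul_le_mul_of_nonneg_right hA (norm_nonneg _)
  -- Leibniz
  have hfun : (fun y ↦ (ContinuousLinearMap.precomp ℝ (fderiv ℝ θ y)).comp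
      (B₀.comp (fderiv ℝ θ y))) = fun y ↦ (P y).comp (Q y) := rfl
  rw [hfun]
  refine (norm_iteratedFDeriv_clm_comp_le hs hP hQ hx hm).trans ?_
  have hterm : ∀ i ∈ Finset.range (m + 1),
      (m.choose i : ℝ) * ‖iteratedFDeriv ℝ i P x‖ * ‖iteratedFDeriv ℝ (m - i) Q x‖ ≤
      (m.choose i : ℝ) * (‖B₀‖ * (2 * η)) := by
    intro i hi
    have hi' : i ≤ m := Nat.lt_succ_iff.mp (Finset.mem_range.mp hi)
    rw [mul_assoc]
    refine mul_le_mul_of_nonneg_left ?_ (by positivity)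
    calc ‖iteratedFDeriv ℝ i P x‖ * ‖iteratedFDeriv ℝ (m - i) Q x‖
        ≤ ‖iteratedFDeriv ℝ i L x‖ * (‖B₀‖ * ‖iteratedFDeriv ℝ (m - i) L x‖) :=
          mul_le_mul (hPb i (by omega)) (hQb (m - i) (by omega)) (norm_nonneg _) (norm_nonneg _)
      _ = ‖B₀‖ * (‖iteratedFDeriv ℝ i L x‖ * ‖iteratedFDeriv ℝ (m - i) L x‖) := by ring
      _ ≤ ‖B₀‖ * (2 * η) :=
          mul_le_mul_of_nonneg_left (hpair i (m - i) (by omega) (by omega)) (norm_nonneg B₀)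
  refine (Finset.sum_le_sum hterm).trans ?_
  rw [← Finset.sum_mul, sum_range_choose_real]
  ring_nf
  rfl

/-! ### The assembled estimate -/

/-- **Pulling `B₀ + F` back along a near-identity map moves it off `B₀` by `O(‖F‖_{Cᵏ}) + O(η)`.**
Let `θ : E → E` be `C^{k+1}` on an open `s ∋ x` and `C^{k+1}`-close to the identity at `x`
(`‖Dθ(x) − id‖ ≤ η`, `‖Dᵐθ(x)‖ ≤ η` for `2 ≤ m ≤ k + 1`, `0 ≤ η ≤ 1`), let `F` be `Cᵏ` on an open
`t ⊇ θ(s)` with `‖DʲF(θ x)‖ ≤ N` (`j ≤ k`), and let `B₀` be a constant form. Then for `m ≤ k`,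
`‖Dᵐ(y ↦ bilinPullback θ (F + B₀)(y) − B₀)(x)‖ ≤ 4ᵏ k! 2^{k+2} N + 2^{k+2} ‖B₀‖ η`
(Petersen 2006, Ch. 10, §3.2: componentwise `Cᵏ` closeness to a background is chart-stable).
[folklore] -/
theorem norm_iteratedFDeriv_bilinPullback_add_const_sub_le {θ : E → E}
    {F : E → E →L[ℝ] E →L[ℝ] ℝ} (B₀ : E →L[ℝ] E →L[ℝ] ℝ) {s t : Set E} (hs : IsOpen s)
    (ht : IsOpen t) {k : ℕ} (hθ : ContDiffOn ℝ (k + 1) θ s) (hF : ContDiffOn ℝ k F t)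
    (hst : MapsTo θ s t) {x : E} (hx : x ∈ s) {η N : ℝ} (hη0 : 0 ≤ η) (hη1 : η ≤ 1)
    (hN : 0 ≤ N) (h1 : ‖fderiv ℝ θ x - ContinuousLinearMap.id ℝ E‖ ≤ η)
    (h2 : ∀ m, 2 ≤ m → m ≤ k + 1 → ‖iteratedFDeriv ℝ m θ x‖ ≤ η)
    (hFb : ∀ j, j ≤ k → ‖iteratedFDeriv ℝ j F (θ x)‖ ≤ N) {m : ℕ} (hm : m ≤ k) :
    ‖iteratedFDeriv ℝ m (fun y ↦ bilinPullback θ (fun z ↦ F z + B₀) y - B₀) x‖ ≤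
      4 ^ k * k ! * 2 ^ (k + 2) * N + 2 ^ (k + 2) * ‖B₀‖ * η := by
  -- split `bilinPullback θ (F + B₀) − B₀ = bilinPullback θ F + (bilinPullback θ B₀ − B₀)`
  set G : E → E →L[ℝ] E →L[ℝ] ℝ := fun y ↦
    (ContinuousLinearMap.precomp ℝ (fderiv ℝ θ y)).comp (B₀.comp (fderiv ℝ θ y)) with hGdef
  have hsplit : (fun y ↦ bilinPullback θ (fun z ↦ F z + B₀) y - B₀) =
      bilinPullback θ F + fun y ↦ G y - B₀ := by
    funext y
    rw [Pi.add_apply, bilinPullback_add_apply, hGdef]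
    simp only [bilinPullback_const_apply]
    abel
  have hθk1 : ContDiffOn ℝ ((k : ℕ∞) + 1) θ s := hθ.of_le (by exact_mod_cast le_rfl)
  have hx' : s ∈ 𝓝 x := hs.mem_nhds hx
  have hA : ContDiffAt ℝ k (bilinPullback θ F) x :=
    ((ContDiffOn.bilinPullback hθk1 hF hs hst).contDiffAt hx').of_le le_rfl
  have hGs : ContDiffOn ℝ k G s := by
    have h := ContDiffOn.bilinPullback (B := fun _ ↦ B₀) (t := univ) hθk1 contDiffOn_const hs
      (mapsTo_univ θ s)
    exact h
  have hGx : ContDiffAt ℝ k G x := hGs.contDiffAt hx'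
  have hB : ContDiffAt ℝ k (fun y ↦ G y - B₀) x := hGx.sub contDiffAt_const
  rw [hsplit, iteratedFDeriv_add_apply (hA.of_le (by exact_mod_cast hm))
    (hB.of_le (by exact_mod_cast hm))]
  refine (norm_add_le _ _).trans (add_le_add
    (norm_iteratedFDeriv_bilinPullback_le_of_near_id hs ht hθ hF hst hx hη1 hN h1 h2 hFb hm) ?_)
  -- the constant-form part
  have h4 : (4 : ℝ) ≤ 2 ^ (k + 2) := by
    calc (4 : ℝ) = 2 ^ (0 + 2) := by norm_num
      _ ≤ 2 ^ (k + 2) := pow_le_pow_right₀ one_le_two (by omega)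
  rcases Nat.eq_zero_or_pos m with rfl | hm1
  · -- order zero
    rw [norm_iteratedFDeriv_zero]
    refine (norm_precomp_comp_comp_sub_le B₀ hη0 h1).trans ?_
    have hη2 : η ^ 2 ≤ η := by nlinarith
    calc ‖B₀‖ * (2 * η + η ^ 2) ≤ ‖B₀‖ * (4 * η) := by
          refine mul_le_mul_of_nonneg_left ?_ (norm_nonneg B₀); linarith
      _ = 4 * ‖B₀‖ * η := by ring
      _ ≤ 2 ^ (k + 2) * ‖B₀‖ * η := by gcongr
  · -- positive order: the constant `B₀` drops out
    have hsub : (fun y ↦ G y - B₀) = G - fun _ ↦ B₀ := rfl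
    rw [hsub, iteratedFDeriv_sub_apply (hGx.of_le (by exact_mod_cast hm)) contDiffAt_const,
      iteratedFDeriv_const_of_ne (by omega), Pi.zero_apply, sub_zero]
    refine (norm_iteratedFDeriv_precomp_comp_comp_le B₀ hs hθ hx hη0 hη1 h1 h2 hm1 hm).trans ?_
    have hp : (2 : ℝ) ^ (m + 1) ≤ 2 ^ (k + 2) := pow_le_pow_right₀ one_le_two (by omega)
    gcongr

end Literature.Geometry.Lorentzian

end
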